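import Summits.AtomisticToContinuum.BoseEinsteinCondensation.Theorems.BECThomsonPrincipleGDTransferSeededSecondMomentCount
import Summits.AtomisticToContinuum.BoseEinsteinCondensation.Theorems.BECThomsonPrincipleGDTransferSeededProjectedDichotomyPlainPair
import Summits.AtomisticToContinuum.BoseEinsteinCondensation.Theorems.BECThomsonPrincipleGDTransferModeCounting
import Summits.AtomisticToContinuum.BoseEinsteinCondensation.Theorems.BECInsertionCorrectorCorrectorClosureDensityUniformDichotomyBudget

/-!
# Route `BECThomsonPrinciple`, crux `GDTransfer` (stmt-AtomisticToContinuum-9482), line `seeded-continuity`: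
# stub `stub_bandFromWindow` — the weighted window law empties the middle band of the `n̂₀`-law

Registered stub `stub_bandFromWindow : Sig.stub_bandFromWindow`
(`= ∀ v, IsRepulsiveFiniteRange v → WeightedWindowBoundFor v → BandEmptiness v`,
`Theorems/BECThomsonPrincipleGDTransferSeededWitnessDefs.lean`): the COUNTING step of the line.  If for every window
parameter `M` the near-minimisers of the periodic energy satisfy the weighted window law
`Σ_{0 < 2π‖p‖_∞/L ≤ M√ρ} N⁻¹‖a₀†a_pΨ‖² ≤ K√ρN` (`WeightedWindowBoundFor v`, `ρ = N/L³`), then for all band parameters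
`θ, β` and every `ε > 0` the middle band `θN ≤ n̂₀ < (1−β)N` of the `n̂₀`-law of the near-minimisers carries mass
`≤ ε` at every `(N, L)` with `N ≥ N₀`, `N ≤ ρ₀L³` (`BandEmptiness v`).  Proof (`N = m + 1`, `w_T = ∫|Q_TΨ|²`):
* (C1) `weightedOcc p Ψ ≤ n_p(Ψ)` (landed `PlainPair.mass_dnB_le_cellOccupation`);
* (C2) window plus kinetic tail: `Σ_{p≠0} weightedOcc p ≤ Σ_{window} weightedOcc p + (M²ρ)⁻¹⟨Ψ,HΨ⟩`, since off the
  window `M²ρ < |2πp/L|²` and `Σ_p |2πp/L|² n_p = ∫|∇Ψ|²` (`tsum_fracDispersion_two_mul_cellOccupation`);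
* (C3) Dyson's upper bound `E₀ ≤ 16πRρN` for `N ≥ 2`, `4R < L`, `ρ` small (landed `dud_groundStateEnergy_le`, `R` a range
  radius of `v`), so `⟨Ψ,HΨ⟩ ≤ AρN`, `A = 16πR + 1`, at slack `δ ≤ ρN`, and `E₀ < ∞`;
* (C4) the second-moment count identity `N·Σ_{p≠0} weightedOcc p = Σ_T (|T|+1)(N−|T|) w_T` (landed
  `secondMoment_natCast_mul_tsum_weightedOcc`);
* (C5) Markov on the band `(|T|+1)(N−|T|) ≥ θβN²` (landed `PlainPair.ofReal_mul_bandMass_le_secondMoment`), whence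
  `θβN²·bandMass ≤ N(K√ρN + AρN/(M²ρ))`, i.e. `bandMass ≤ (K√ρ + A/M²)/(θβ) ≤ ε` for `M² = 2A/(εθβ)`,
  `ρ₀ = min(ρ₁, ρ_D/2, (εθβ/2K)², 2/(4R+1)³)`, `N₀ = max(N₁, 2)`, `δ = min(δ_W, ρN)`.
[folklore] (KennedyLiebShastry1988; LSSY2005 Thm 2.2 (2.14), §1.2 (1.17)–(1.19), App. A).
-/

noncomputable section

open MeasureTheory Filter
open scoped ENNReal NNReal ComplexConjugate

namespace Summit.AtomisticToContinuum.BoseEinsteinCondensation.Cruxes.GDTransfer.Seeded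

namespace BandFromWindow

open Literature.MathematicalPhysics.QuantumManyBody.BoseGas
open Summit.AtomisticToContinuum.BoseEinsteinCondensation.Theorems.GaussianDominationCan.Negative (InWindow)
open Summit.AtomisticToContinuum.BoseEinsteinCondensation.Cruxes.GDTransfer.DysonDressedWitness
open Summit.AtomisticToContinuum.BoseEinsteinCondensation.Theorems.ModeCounting (norm_sq_le_sum_sq)

variable {m : ℕ} {L : ℝ}

/-! ## (C1) The weighted occupation is below the occupation -/

/-- **(C1)** `weightedOcc p Ψ = N⁻¹‖a₀†a_pΨ‖² ≤ n_p(Ψ)` (the landed `PlainPair.mass_dnB_le_cellOccupation`). [folklore] -/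
theorem weightedOcc_le_cellOccupation (hL : 0 < L) (p : Fin 3 → ℤ) (Ψ : PeriodicTrialState (m + 1) L) :
    weightedOcc m L p Ψ.ψ ≤ cellOccupation (m + 1) L (planeWaveMode L p) Ψ.ψ := by
  have h := PlainPair.mass_dnB_le_cellOccupation hL p Ψ
  have hc : ((m + 1 : ℕ) : ℝ) = (m : ℝ) + 1 := by push_cast; ring
  unfold weightedOcc plainDown
  rw [hc]
  exact h

/-! ## (C2) Window plus kinetic tail -/

/-- **(C2)** `Σ_{p≠0} weightedOcc p ≤ Σ_{window} weightedOcc p + D⁻¹⟨Ψ, HΨ⟩` whenever `D ≤ |2πp/L|²` off the window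
(`weightedOcc p ≤ n_p` and the gradient Parseval `Σ_p |2πp/L|² n_p = ∫|∇Ψ|² ≤ ⟨Ψ,HΨ⟩`). [folklore] -/
theorem tsum_indicator_weightedOcc_le (hL : 0 < L) (v : ℝ → ℝ≥0∞) (M : ℝ) (Ψ : PeriodicTrialState (m + 1) L)
    {D : ℝ≥0∞} (hD0 : D ≠ 0) (hDtop : D ≠ ⊤)
    (hUV : ∀ p : Fin 3 → ℤ, p ≠ 0 → ¬ InWindow M m L p → D ≤ fracDispersion 2 L p) :
    ∑' p : Fin 3 → ℤ, {p : Fin 3 → ℤ | p ≠ 0}.indicator (fun p => weightedOcc m L p Ψ.ψ) p ≤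
      windowSum M m L (fun p => weightedOcc m L p Ψ.ψ) + D⁻¹ * periodicEnergy v Ψ := by
  -- adapted from `condensate_ge_half_of_windowSum`
  set w : (Fin 3 → ℤ) → ℝ≥0∞ := fun p => weightedOcc m L p Ψ.ψ with hw
  set n : (Fin 3 → ℤ) → ℝ≥0∞ := fun k => cellOccupation (m + 1) L (planeWaveMode L k) Ψ.ψ with hn
  set W : Set (Fin 3 → ℤ) := {p | p ≠ 0 ∧ InWindow M m L p} with hW
  have hpt : ∀ k, {p : Fin 3 → ℤ | p ≠ 0}.indicator w k ≤ W.indicator w k + D⁻¹ * (fracDispersion 2 L k * n k) := by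
    intro k
    by_cases hk0 : k = 0
    · rw [Set.indicator_of_notMem (fun h : k ≠ 0 => h hk0)]
      exact bot_le
    · rw [Set.indicator_of_mem (show k ∈ {p : Fin 3 → ℤ | p ≠ 0} from hk0)]
      by_cases hkW : InWindow M m L k
      · rw [Set.indicator_of_mem (show k ∈ W from ⟨hk0, hkW⟩)]
        exact le_self_add
      · refine le_add_left ?_
        calc w k ≤ n k := weightedOcc_le_cellOccupation hL k Ψ
          _ = D⁻¹ * D * n k := by rw [ENNReal.inv_mul_cancel hD0 hDtop, one_mul]
          _ ≤ D⁻¹ * fracDispersion 2 L k * n k := by gcongr; exact hUV k hk0 hkW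
          _ = D⁻¹ * (fracDispersion 2 L k * n k) := mul_assoc _ _ _
  have hTsum : D⁻¹ * ∑' k, fracDispersion 2 L k * n k ≤ D⁻¹ * periodicEnergy v Ψ := by
    gcongr
    calc ∑' k, fracDispersion 2 L k * n k = ∫⁻ X in cellN (m + 1) L, kineticDensity Ψ.ψ X :=
          tsum_fracDispersion_two_mul_cellOccupation hL Ψ
      _ ≤ periodicEnergy v Ψ := lintegral_mono fun X => le_self_add
  calc ∑' p, {p : Fin 3 → ℤ | p ≠ 0}.indicator w p
      ≤ ∑' k, (W.indicator w k + D⁻¹ * (fracDispersion 2 L k * n k)) := ENNReal.tsum_le_tsum hpt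
    _ = (∑' k, W.indicator w k) + D⁻¹ * ∑' k, fracDispersion 2 L k * n k := by
        rw [ENNReal.tsum_add, ENNReal.tsum_mul_left]
    _ ≤ windowSum M m L w + D⁻¹ * periodicEnergy v Ψ := add_le_add le_rfl hTsum

/-- **The ultraviolet condition off the window**: for `p` off the window `2π‖p‖_∞/L ≤ M√ρ` (`ρ = N/L³`, `M ≥ 0`),
`M²ρ ≤ |2πp/L|²`. [folklore] -/
theorem ofReal_le_fracDispersion_of_not_inWindow (hL : 0 < L) {M : ℝ} (hM : 0 ≤ M) {p : Fin 3 → ℤ}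
    (hp : ¬ InWindow M m L p) :
    ENNReal.ofReal (M ^ 2 * (((m + 1 : ℕ) : ℝ) / L ^ 3)) ≤ fracDispersion 2 L p := by
  -- adapted from `stub_modeCounting`
  set ρ : ℝ := ((m + 1 : ℕ) : ℝ) / L ^ 3 with hρ
  have hρ0 : 0 ≤ ρ := by positivity
  have hlt : M * Real.sqrt ρ < 2 * Real.pi * ‖(fun j => (p j : ℝ))‖ / L := not_le.mp hp
  rw [lt_div_iff₀ hL] at hlt
  have key : M ^ 2 * ρ * L ^ 2 < 4 * Real.pi ^ 2 * ‖(fun j => (p j : ℝ))‖ ^ 2 := by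
    calc M ^ 2 * ρ * L ^ 2 = (M * Real.sqrt ρ * L) ^ 2 := by
          rw [mul_pow, mul_pow, Real.sq_sqrt hρ0]
      _ < (2 * Real.pi * ‖(fun j => (p j : ℝ))‖) ^ 2 :=
          pow_lt_pow_left₀ hlt (by positivity) two_ne_zero
      _ = 4 * Real.pi ^ 2 * ‖(fun j => (p j : ℝ))‖ ^ 2 := by ring
  rw [fracDispersion_two]
  refine ENNReal.ofReal_le_ofReal ?_
  rw [le_div_iff₀ (by positivity)]
  calc M ^ 2 * ρ * L ^ 2 ≤ 4 * Real.pi ^ 2 * ‖(fun j => (p j : ℝ))‖ ^ 2 := key.le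
    _ ≤ 4 * Real.pi ^ 2 * ∑ j, (p j : ℝ) ^ 2 := by gcongr; exact norm_sq_le_sum_sq p

/-- **A small density forces a large side**: `N ≥ 2` and `N ≤ (2/(4R+1)³)·L³` give `4R < L`. [folklore] -/
theorem four_mul_lt_side {R N : ℝ} (hR : 0 < R) (hL : 0 < L) (hN2 : 2 ≤ N) (hNL : N ≤ 2 / (4 * R + 1) ^ 3 * L ^ 3) :
    4 * R < L := by
  -- adapted from `bandMass_le_of_emptyWindow`
  have h3 : (2 : ℝ) ≤ 2 / (4 * R + 1) ^ 3 * L ^ 3 := hN2.trans hNL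
  rw [div_mul_eq_mul_div, le_div_iff₀ (by positivity)] at h3
  have h2 : (4 * R + 1) ^ 3 ≤ L ^ 3 := by nlinarith
  have h4 : 4 * R + 1 ≤ L := le_of_pow_le_pow_left₀ three_ne_zero hL.le h2
  linarith

end BandFromWindow

open Literature.MathematicalPhysics.QuantumManyBody.BoseGas
open Summit.AtomisticToContinuum.BoseEinsteinCondensation.Theorems.GaussianDominationCan.Negative (InWindow)
open Summit.AtomisticToContinuum.BoseEinsteinCondensation.Cruxes.GDTransfer.DysonDressedWitness
open Summit.AtomisticToContinuum.BoseEinsteinCondensation.Theorems.CorrectorClosure.VolumeHomotopySumRuleDomination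
  (dud_groundStateEnergy_le)
open BandFromWindow

/-- **Registered stub `stub_bandFromWindow`** (line `seeded-continuity` of crux `GDTransfer`, stmt-AtomisticToContinuum-9482):
the weighted window law for the near-minimisers empties the middle band of their `n̂₀`-law —
`∀ v, IsRepulsiveFiniteRange v → WeightedWindowBoundFor v → BandEmptiness v` (second-moment count identity, kinetic tail
off the window, Dyson's upper bound, Markov on the band). [folklore] (KennedyLiebShastry1988; LSSY2005 Thm 2.2, App. A) -/
theorem stub_bandFromWindow : Sig.stub_bandFromWindow := by
  intro v hv hW θ β hθ hβ _ ε hε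
  -- constants attached to `v`: a range radius and Dyson's upper bound `E₀ ≤ 16πRρN`
  obtain ⟨R, hR, hvR⟩ := hv.exists_pos_range
  obtain ⟨ρD, hρD, hDyson⟩ := dud_groundStateEnergy_le hR
  set A : ℝ := 16 * Real.pi * R + 1 with hA
  have hA0 : 0 < A := by positivity
  have hεθβ : 0 < ε * θ * β := by positivity
  -- the window parameter: `A/M² = εθβ/2`
  set M : ℝ := Real.sqrt (2 * A / (ε * θ * β)) with hM
  have hM0 : 0 < M := Real.sqrt_pos.2 (by positivity)
  have hM2 : M ^ 2 = 2 * A / (ε * θ * β) := Real.sq_sqrt (by positivity)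
  obtain ⟨ρ₁, K, hρ₁, hK, N₁, hWin⟩ := hW M hM0
  -- the density threshold
  set ρK : ℝ := (ε * θ * β / (2 * K)) ^ 2 with hρK
  have hρK0 : 0 < ρK := by positivity
  refine ⟨min (min ρ₁ (ρD / 2)) (min ρK (2 / (4 * R + 1) ^ 3)),
    lt_min (lt_min hρ₁ (by positivity)) (lt_min hρK0 (by positivity)), max N₁ 2, ?_⟩
  intro m hNm L hL hNL
  have hN1 : N₁ ≤ m + 1 := le_of_max_le_left hNm
  have hN2 : 2 ≤ m + 1 := le_of_max_le_right hNm
  set N : ℝ := ((m + 1 : ℕ) : ℝ) with hN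
  have hN2r : (2 : ℝ) ≤ N := by rw [hN]; exact_mod_cast hN2
  have hNpos : 0 < N := by linarith
  have hNm' : N = (m : ℝ) + 1 := by rw [hN]; push_cast; ring
  have hL3 : 0 < L ^ 3 := by positivity
  set ρ : ℝ := N / L ^ 3 with hρ
  have hρpos : 0 < ρ := div_pos hNpos hL3
  have hNρ : N = ρ * L ^ 3 := by rw [hρ]; field_simp
  have hρle : ρ ≤ min (min ρ₁ (ρD / 2)) (min ρK (2 / (4 * R + 1) ^ 3)) := by
    rw [hρ, div_le_iff₀ hL3]; exact hNL
  have hρ₁' : ρ ≤ ρ₁ := hρle.trans ((min_le_left _ _).trans (min_le_left _ _))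
  have hρD' : ρ < ρD := by
    have := hρle.trans ((min_le_left _ _).trans (min_le_right _ _)); linarith
  have hρK' : ρ ≤ ρK := hρle.trans ((min_le_right _ _).trans (min_le_left _ _))
  have hρR : ρ ≤ 2 / (4 * R + 1) ^ 3 := hρle.trans ((min_le_right _ _).trans (min_le_right _ _))
  -- the side is large, Dyson's bound applies and `E₀ < ∞`
  have hL4 : 4 * R < L :=
    four_mul_lt_side hR hL hN2r (by rw [← div_le_iff₀ hL3]; exact hρR)
  have hE0 : periodicGroundStateEnergy v (m + 1) L ≤ ENNReal.ofReal (16 * Real.pi * R * ρ * N) :=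
    hDyson (m + 1) hN2 L hL4 hρD' v hvR
  have hE0top : periodicGroundStateEnergy v (m + 1) L ≠ ⊤ := ne_top_of_le_ne_top ENNReal.ofReal_ne_top hE0
  have hNL1 : ((m + 1 : ℕ) : ℝ) ≤ ρ₁ * L ^ 3 := by
    rw [← hN, hNρ]; exact mul_le_mul_of_nonneg_right hρ₁' hL3.le
  obtain ⟨δW, hδW, hWΨ⟩ := hWin m hN1 L hL hNL1 hE0top
  -- the slack `δ = min(δ_W, ρN)`
  refine ⟨min δW (ENNReal.ofReal (ρ * N)), lt_min hδW (ENNReal.ofReal_pos.2 (by positivity)), ?_⟩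
  intro Ψ hΨ
  have hΨW : periodicEnergy v Ψ ≤ periodicGroundStateEnergy v (m + 1) L + δW :=
    hΨ.trans (add_le_add le_rfl (min_le_left _ _))
  have hΨE : periodicEnergy v Ψ ≤ ENNReal.ofReal (A * ρ * N) := by
    calc periodicEnergy v Ψ
        ≤ periodicGroundStateEnergy v (m + 1) L + ENNReal.ofReal (ρ * N) :=
          hΨ.trans (add_le_add le_rfl (min_le_right _ _))
      _ ≤ ENNReal.ofReal (16 * Real.pi * R * ρ * N) + ENNReal.ofReal (ρ * N) := add_le_add hE0 le_rfl
      _ = ENNReal.ofReal (A * ρ * N) := by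
          rw [← ENNReal.ofReal_add (by positivity) (by positivity), hA]
          congr 1
          ring
  -- (a) Markov on the band and the second-moment count identity
  have h1 : ENNReal.ofReal (θ * β * N ^ 2) * bandMass m L θ β Ψ.ψ ≤
      ((m + 1 : ℕ) : ℝ≥0∞) * ∑' p : Fin 3 → ℤ, {p : Fin 3 → ℤ | p ≠ 0}.indicator (fun p => weightedOcc m L p Ψ.ψ) p := by
    rw [secondMoment_natCast_mul_tsum_weightedOcc m L hL Ψ, hNm']
    exact PlainPair.ofReal_mul_bandMass_le_secondMoment L θ hβ Ψ.ψ
  -- (b) window plus kinetic tail, with `D = M²ρ`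
  set D : ℝ≥0∞ := ENNReal.ofReal (M ^ 2 * ρ) with hD
  have hDpos : 0 < M ^ 2 * ρ := by positivity
  have hD0 : D ≠ 0 := (ENNReal.ofReal_pos.2 hDpos).ne'
  have h2 : ∑' p : Fin 3 → ℤ, {p : Fin 3 → ℤ | p ≠ 0}.indicator (fun p => weightedOcc m L p Ψ.ψ) p ≤
      windowSum M m L (fun p => weightedOcc m L p Ψ.ψ) + D⁻¹ * periodicEnergy v Ψ :=
    tsum_indicator_weightedOcc_le hL v M Ψ hD0 ENNReal.ofReal_ne_top
      fun p _ hpW => ofReal_le_fracDispersion_of_not_inWindow hL hM0.le hpW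
  -- (c) the two numerical budgets `K√ρ N ≤ εθβN/2` and `AρN/(M²ρ) = εθβN/2`
  have hKρ : K * Real.sqrt ρ ≤ ε * θ * β / 2 := by
    calc K * Real.sqrt ρ ≤ K * Real.sqrt ρK := by gcongr
      _ = K * (ε * θ * β / (2 * K)) := by rw [hρK, Real.sqrt_sq (by positivity)]
      _ = ε * θ * β / 2 := by field_simp
  have hwin : windowSum M m L (fun p => weightedOcc m L p Ψ.ψ) ≤ ENNReal.ofReal (ε * θ * β / 2 * N) := by
    refine (hWΨ Ψ hΨW).trans (ENNReal.ofReal_le_ofReal ?_)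
    rw [← hρ, ← hNm']
    calc K * Real.sqrt ρ * N ≤ ε * θ * β / 2 * N := mul_le_mul_of_nonneg_right hKρ hNpos.le
      _ = ε * θ * β / 2 * N := rfl
  have htail : D⁻¹ * periodicEnergy v Ψ ≤ ENNReal.ofReal (ε * θ * β / 2 * N) := by
    calc D⁻¹ * periodicEnergy v Ψ ≤ D⁻¹ * ENNReal.ofReal (A * ρ * N) := by gcongr
      _ = ENNReal.ofReal (A * ρ * N / (M ^ 2 * ρ)) := by
          rw [← ENNReal.div_eq_inv_mul, hD, ← ENNReal.ofReal_div_of_pos hDpos]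
      _ = ENNReal.ofReal (ε * θ * β / 2 * N) := by
          congr 1
          rw [hM2]
          field_simp
  have h3 : ∑' p : Fin 3 → ℤ, {p : Fin 3 → ℤ | p ≠ 0}.indicator (fun p => weightedOcc m L p Ψ.ψ) p ≤
      ENNReal.ofReal (ε * θ * β * N) := by
    calc _ ≤ windowSum M m L (fun p => weightedOcc m L p Ψ.ψ) + D⁻¹ * periodicEnergy v Ψ := h2
      _ ≤ ENNReal.ofReal (ε * θ * β / 2 * N) + ENNReal.ofReal (ε * θ * β / 2 * N) := add_le_add hwin htail
      _ = ENNReal.ofReal (ε * θ * β * N) := by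
          rw [← ENNReal.ofReal_add (by positivity) (by positivity)]
          congr 1
          ring
  -- (d) conclusion: `θβN²·bandMass ≤ N·εθβN`
  have hpos : 0 < θ * β * N ^ 2 := by positivity
  have h4 : ENNReal.ofReal (θ * β * N ^ 2) * bandMass m L θ β Ψ.ψ ≤ ENNReal.ofReal (θ * β * N ^ 2 * ε) := by
    calc ENNReal.ofReal (θ * β * N ^ 2) * bandMass m L θ β Ψ.ψ
        ≤ ((m + 1 : ℕ) : ℝ≥0∞) * ENNReal.ofReal (ε * θ * β * N) := h1.trans (mul_le_mul' le_rfl h3)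
      _ = ENNReal.ofReal (θ * β * N ^ 2 * ε) := by
          rw [← ENNReal.ofReal_natCast, ← hN, ← ENNReal.ofReal_mul hNpos.le]
          congr 1
          ring
  calc bandMass m L θ β Ψ.ψ
      ≤ ENNReal.ofReal (θ * β * N ^ 2 * ε) / ENNReal.ofReal (θ * β * N ^ 2) := by
        rw [ENNReal.le_div_iff_mul_le (Or.inl (ENNReal.ofReal_pos.2 hpos).ne') (Or.inl ENNReal.ofReal_ne_top),
          mul_comm]
        exact h4
    _ = ENNReal.ofReal (θ * β * N ^ 2 * ε / (θ * β * N ^ 2)) := (ENNReal.ofReal_div_of_pos hpos).symm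
    _ = ENNReal.ofReal ε := by
        congr 1
        field_simp

end Summit.AtomisticToContinuum.BoseEinsteinCondensation.Cruxes.GDTransfer.Seeded

end
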